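import Summits.RiemannHypothesis.RiemannHypothesis.Theorems.PlantedLi

/-!
# W-06 cycle 7 «DETECTION COST ATLAS», cell C4⁷-bis — the LI BLINDNESS LAW, KERNEL (rh-idea-6 g15) — part (i) of two

(CA116)/(CA137) lane slot (4b-i).  The desk cut of record `PlantedLiBlindness.lean` 05421ef16d445f56 · 521 (ONE file, §1–§4 =
l.130–626 VERBATIM of `pub/ideators/rh-idea-6/g15/c47b/PlantedLiBlind-rh-idea-6-g15-rev2.lean` sha16 458d796713b70991 · 630,
ns `RhIdea6.G15.C47b`, re-pointed by ONE import onto the defs of record `Theorems/PlantedLi.lean` = rh-idea-4 g14's objects,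
LAND #898) bounced on the 400-line lint (p711378); this RE-CUT splits it at the §3/§4 boundary with the bodies byte-verbatim:
part (i) = THIS file (§1–§3 = rev-2 l.130–349), part (ii) = `Theorems/PlantedLiBlindnessLow.lean` (§4 = rev-2 l.352–626, the LOW
range `1 ≤ n ≤ 899`; imports this file).  Rev 2 of part (i): the top-level lemma `exp_neg_two_le` (`exp(−2) ≤ 1/3`) of the cut
is DROPPED (gate `dedup.landed` vs `Literature.Computability.Complexity.DenseSearch.exp_neg_two_le_third`, p711712) and its
3-line proof inlined at its single use site in `exp_le_of_le_liBlindDegree`; nothing else differs.  Credit rh-idea-6 g15.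
LABEL: RH-FREE PROOF-OF-DATA about a PLANTED sequence (model A); tier K (0 `sorry`, standard axioms).
What is proved here: ζ side `keiperLiCoeff_ge_low` (`1000 ≤ T → RiemannHypothesisUpTo T → 900 ≤ n → n ≤ T² → 1.349·n ≤ λ_n`,
from `LiTheory.liAsymptoticLawAllRange_holds` + the `BudgetLog` lemmas); planted side `plantedLiTerm_ge`
(`2 − 2·exp(n·δ/((δ − 1/2)² + γ²)) ≤ plantedLiTerm γ δ n`); the law `plantedLi_pos` and **`blindL_holds : BlindL`**
(rh-idea-4's typed statement, `b_L = (γ²/δ)(log(γ²/δ) − 2)`); RH-free corollaries at the kernel height `T = 10³`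
(`riemannHypothesisUpTo_1000`): `blindL_height1000`, `plantedLi_pos_DH_log`, `plantedLi_pos_DH`, `liBlindDegree_DH_le`;
`not_liSees_below`.  Nothing here bears on the truth of RH.
-/

/-! ## rh-idea-6 g15: the kernel blindness law -/

noncomputable section

namespace RhIdea6.G15.C47b

open Literature.NumberTheory.LFunctions Literature.NumberTheory.DiophantineGeometry
open Summit.RiemannHypothesis.RiemannHypothesis.Theorems.LiTheory
open RhIdea4.G14.W06C67

/-! ### §1 ζ side: a linear lower bound for `λ_n` below the verified height -/

/-- The cosh defect is negligible on `900 ≤ n ≤ T²`: `liCoshDefect n T ≤ 0.000341·n` (the `have`s of the tree's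
`liHeightBudgetLog_low`, exported). -/
theorem liCoshDefect_le_low {n : ℕ} {T : ℝ} (hT : 1000 ≤ T) (hn : 900 ≤ n) (hnT : (n : ℝ) ≤ T ^ 2) :
    liCoshDefect n T ≤ 0.000341 * n := by
  have hT0 : 0 < T := by linarith
  have hπ := Real.pi_gt_d2
  have hπ0 := Real.pi_pos
  have hn' : (900 : ℝ) ≤ n := by exact_mod_cast hn
  have hn0 : (0 : ℝ) < n := by linarith
  have hlogT : 6 ≤ Real.log T := BudgetLog.six_le_log (by linarith)
  have hlin := BudgetLog.log_le_lin hT0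
  set x : ℝ := (n : ℝ) / (2 * T ^ 2) with hx
  have hx0 : 0 ≤ x := by positivity
  have hx1 : x ≤ 1 / 2 := by
    rw [hx, div_le_iff₀ (by positivity)]; linarith
  have hcosh := BudgetLog.cosh_sub_one_le_low hx0 hx1
  have hx2 : x ^ 2 ≤ n / (4 * T ^ 2) := by
    have e : x ^ 2 = (n : ℝ) * n / (4 * T ^ 2 * T ^ 2) := by rw [hx]; ring
    rw [e, div_le_div_iff₀ (by positivity) (by positivity)]
    have : (n : ℝ) * n ≤ n * T ^ 2 := mul_le_mul_of_nonneg_left hnT hn0.le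
    nlinarith [sq_nonneg T]
  have hK0 := BudgetLog.K_nonneg hT
  have hK := BudgetLog.K_le_sq hT
  have htail : liCoshTail n T ≤ 0.00034 * n := by
    unfold liCoshTail
    calc (Real.cosh (n / (2 * T ^ 2)) - 1) *
          (T * (Real.log (T / (2 * Real.pi)) + 1) / Real.pi + 1.24 * Real.log T + 18)
        ≤ (9 / 16 * (n / (4 * T ^ 2))) * (0.0024 * T ^ 2) :=
          mul_le_mul (hcosh.trans (by nlinarith)) hK hK0 (by positivity)
      _ = 0.0003375 * n := by field_simp; ring
      _ ≤ 0.00034 * n := by nlinarith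
  have hphase : (n : ℝ) / 2 * (Real.log T / (4 * Real.pi * T ^ 2)) ≤ 0.000001 * n := by
    have h1 : Real.log T / (4 * Real.pi * T ^ 2) ≤ 0.000002 := by
      rw [div_le_iff₀ (by positivity)]
      nlinarith
    nlinarith
  unfold liCoshDefect
  linarith

/-- **ζ side.** RH verified to `T ≥ 1000` ⇒ `λ_n ≥ 1.349·n` for `900 ≤ n ≤ T²`
(`λ_n ≥ liMainTerm n − 2√n log n − liCoshDefect n T ≥ n((13/30)·6 − 1.25 − 0.000341)`). -/
theorem keiperLiCoeff_ge_low {n : ℕ} {T : ℝ} (hT : 1000 ≤ T) (hRH : RiemannHypothesisUpTo T)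
    (hn : 900 ≤ n) (hnT : (n : ℝ) ≤ T ^ 2) : 1.349 * (n : ℝ) ≤ keiperLiCoeff n := by
  have hlaw := liAsymptoticLawAllRange_holds hT hRH hn
  have hdef := liCoshDefect_le_low hT hn hnT
  have hmain := BudgetLog.main_sub_band_ge hn
  have hn' : (900 : ℝ) ≤ n := by exact_mod_cast hn
  have hn0 : (0 : ℝ) ≤ n := by linarith
  have hlogn : 6 ≤ Real.log n := BudgetLog.six_le_log (by linarith)
  have h1 := (abs_le.1 hlaw).1
  nlinarith [mul_le_mul_of_nonneg_left hlogn hn0]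

/-! ### §2 planted side: the closed form of the quadruple's Li term -/

/-- The decaying factor has modulus `≤ 1` (`δ ≥ 0`). -/
theorem norm_one_sub_inv_rho_le_one {γ δ : ℝ} (hδ : 0 ≤ δ) (hγ : γ ≠ 0) : ‖1 - 1 / rho γ δ‖ ≤ 1 := by
  have h : (1/2 + δ) ^ 2 + γ ^ 2 ≠ 0 := by positivity
  have hsq : ‖1 - 1 / rho γ δ‖ ^ 2 ≤ 1 := by
    rw [← Complex.normSq_eq_norm_sq, normSq_one_sub_inv_rho γ δ h, div_le_one (by positivity)]
    nlinarith
  nlinarith [norm_nonneg (1 - 1 / rho γ δ)]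

/-- The growing factor: `‖1 − 1/ρ′‖ⁿ ≤ exp(n·δ/((δ − 1/2)² + γ²))` (`‖1 − 1/ρ′‖² = 1 + 2δ/((δ − 1/2)² + γ²) ≤ e^{2δ/…}`). -/
theorem norm_one_sub_inv_rho'_pow_le {γ δ : ℝ} (hγ : γ ≠ 0) (n : ℕ) :
    ‖1 - 1 / rho' γ δ‖ ^ n ≤ Real.exp (n * (δ / ((δ - 1/2) ^ 2 + γ ^ 2))) := by
  have h : (1/2 - δ) ^ 2 + γ ^ 2 ≠ 0 := by positivity
  have hD : 0 < (δ - 1/2) ^ 2 + γ ^ 2 := by positivity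
  have hsq : ‖1 - 1 / rho' γ δ‖ ^ 2 = 1 + 2 * (δ / ((δ - 1/2) ^ 2 + γ ^ 2)) := by
    rw [← Complex.normSq_eq_norm_sq, normSq_one_sub_inv_rho' γ δ h]
    have e : (δ + 1/2) ^ 2 + γ ^ 2 = ((δ - 1/2) ^ 2 + γ ^ 2) + 2 * δ := by ring
    rw [e, add_div, div_self hD.ne', mul_div_assoc]
  have h1 : ‖1 - 1 / rho' γ δ‖ ≤ Real.exp (δ / ((δ - 1/2) ^ 2 + γ ^ 2)) := by
    have he : Real.exp (δ / ((δ - 1/2) ^ 2 + γ ^ 2)) ^ 2 = Real.exp (2 * (δ / ((δ - 1/2) ^ 2 + γ ^ 2))) := by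
      rw [← Real.exp_nat_mul]; norm_num
    have h2 : ‖1 - 1 / rho' γ δ‖ ^ 2 ≤ Real.exp (δ / ((δ - 1/2) ^ 2 + γ ^ 2)) ^ 2 := by
      rw [hsq, he]
      linarith [Real.add_one_le_exp (2 * (δ / ((δ - 1/2) ^ 2 + γ ^ 2)))]
    have hpos := Real.exp_pos (δ / ((δ - 1/2) ^ 2 + γ ^ 2))
    nlinarith [norm_nonneg (1 - 1 / rho' γ δ)]
  calc ‖1 - 1 / rho' γ δ‖ ^ n ≤ Real.exp (δ / ((δ - 1/2) ^ 2 + γ ^ 2)) ^ n :=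
        pow_le_pow_left₀ (norm_nonneg _) h1 n
    _ = Real.exp (n * (δ / ((δ - 1/2) ^ 2 + γ ^ 2))) := (Real.exp_nat_mul _ n).symm

/-- **Planted side, closed form.** `plantedLiTerm γ δ n ≥ 2 − 2·exp(n·δ/((δ − 1/2)² + γ²))`. -/
theorem plantedLiTerm_ge {γ δ : ℝ} (hδ : 0 ≤ δ) (hγ : γ ≠ 0) (n : ℕ) :
    2 - 2 * Real.exp (n * (δ / ((δ - 1/2) ^ 2 + γ ^ 2))) ≤ plantedLiTerm γ δ n := by
  have h := abs_plantedLiTerm_sub_four_le γ δ n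
  have h1n : ‖1 - 1 / rho γ δ‖ ^ n ≤ 1 := pow_le_one₀ (norm_nonneg _) (norm_one_sub_inv_rho_le_one hδ hγ)
  have h2 := norm_one_sub_inv_rho'_pow_le (δ := δ) hγ n
  have h3 := (abs_le.1 h).1
  linarith

/-- The exponent against the bare height: `exp(n·δ/((δ − 1/2)² + γ²)) ≤ exp(nδ/γ²)`. -/
theorem exp_planted_le {γ δ : ℝ} (hδ : 0 ≤ δ) (hγ : γ ≠ 0) (n : ℕ) :
    Real.exp (n * (δ / ((δ - 1/2) ^ 2 + γ ^ 2))) ≤ Real.exp (n * δ / γ ^ 2) := by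
  apply Real.exp_le_exp.2
  have hγ2 : 0 < γ ^ 2 := by positivity
  have hle : δ / ((δ - 1/2) ^ 2 + γ ^ 2) ≤ δ / γ ^ 2 :=
    div_le_div_of_nonneg_left hδ hγ2 (by nlinarith [sq_nonneg (δ - 1/2)])
  have hn0 : (0 : ℝ) ≤ n := Nat.cast_nonneg n
  calc (n : ℝ) * (δ / ((δ - 1/2) ^ 2 + γ ^ 2)) ≤ n * (δ / γ ^ 2) := mul_le_mul_of_nonneg_left hle hn0
    _ = n * δ / γ ^ 2 := by ring

/-! ### §3 The law `blind_L` -/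

/-- **KERNEL LAW `blind_L` (implicit form).** RH verified to `T ≥ 1000`, `0 ≤ δ`, `γ ≠ 0`, `900 ≤ n ≤ T²` and
`exp(nδ/γ²) ≤ 0.67·n + 1` ⇒ the planted Li coefficient `λ_n^{pl} = λ_n + plantedLiTerm γ δ n` is `> 0`
(`λ_n^{pl} ≥ 1.349 n + 2 − 2(0.67 n + 1) = 0.009 n > 0`). -/
theorem plantedLi_pos {T γ δ : ℝ} {n : ℕ} (hT : 1000 ≤ T) (hRH : RiemannHypothesisUpTo T)
    (hδ : 0 ≤ δ) (hγ : γ ≠ 0) (hn : 900 ≤ n) (hnT : (n : ℝ) ≤ T ^ 2)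
    (hexp : Real.exp (n * δ / γ ^ 2) ≤ 0.67 * n + 1) : 0 < plantedLi γ δ n := by
  have hl := keiperLiCoeff_ge_low hT hRH hn hnT
  have hp := plantedLiTerm_ge hδ hγ n
  have hmono := exp_planted_le hδ hγ n
  have hn' : (900 : ℝ) ≤ n := by exact_mod_cast hn
  unfold plantedLi
  linarith

/-- From the closed-form degree `n ≤ b_L(γ,δ) = (γ²/δ)(log(γ²/δ) − 2)` to the implicit condition:
`exp(nδ/γ²) ≤ 0.67 n + 1` (if `nδ/γ² ≤ 1` the left side is `≤ e ≤ 3`; else `γ²/δ < n` and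
`exp(nδ/γ²) ≤ exp(log(γ²/δ) − 2) = (γ²/δ)e^{−2} < n/3`). -/
theorem exp_le_of_le_liBlindDegree {γ δ : ℝ} {n : ℕ} (hγ : γ ≠ 0) (hδ : 0 < δ) (hn : 900 ≤ n)
    (hnb : (n : ℝ) ≤ liBlindDegree γ δ) : Real.exp (n * δ / γ ^ 2) ≤ 0.67 * n + 1 := by
  have hn' : (900 : ℝ) ≤ n := by exact_mod_cast hn
  have hγ2 : 0 < γ ^ 2 := by positivity
  have hq : 0 < γ ^ 2 / δ := div_pos hγ2 hδ
  by_cases hu : (n : ℝ) * δ / γ ^ 2 ≤ 1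
  · calc Real.exp (n * δ / γ ^ 2) ≤ Real.exp 1 := Real.exp_le_exp.2 hu
      _ ≤ 3 := by have := Real.exp_one_lt_d9; linarith
      _ ≤ 0.67 * n + 1 := by linarith
  · rw [not_le, lt_div_iff₀ hγ2, one_mul] at hu
    have hlt : γ ^ 2 / δ < n := by rw [div_lt_iff₀ hδ]; linarith
    have hle : (n : ℝ) * δ / γ ^ 2 ≤ Real.log (γ ^ 2 / δ) - 2 := by
      unfold liBlindDegree at hnb
      rw [div_le_iff₀ hγ2]
      have e : γ ^ 2 / δ * (Real.log (γ ^ 2 / δ) - 2) * δ = (Real.log (γ ^ 2 / δ) - 2) * γ ^ 2 := by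
        field_simp
      have := mul_le_mul_of_nonneg_right hnb hδ.le
      linarith
    calc Real.exp (n * δ / γ ^ 2) ≤ Real.exp (Real.log (γ ^ 2 / δ) - 2) := Real.exp_le_exp.2 hle
      _ = γ ^ 2 / δ * Real.exp (-2) := by rw [sub_eq_add_neg, Real.exp_add, Real.exp_log hq]
      _ ≤ γ ^ 2 / δ * (1 / 3) := mul_le_mul_of_nonneg_left (by
          -- `exp (−2) ≤ 1/3` (= tree `Literature.Computability.Complexity.DenseSearch.exp_neg_two_le_third`, inlined
          -- here to keep the imports minimal; the cut's top-level restatement bounced as `dedup.landed`, p711712)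
          have h3 : (3 : ℝ) ≤ Real.exp 2 := by linarith [Real.add_one_le_exp (2 : ℝ)]
          rw [Real.exp_neg, inv_eq_one_div, div_le_div_iff₀ (Real.exp_pos 2) (by norm_num : (0 : ℝ) < 3)]
          linarith) hq.le
      _ ≤ 0.67 * n + 1 := by linarith

/-- **`blind_L` as typed by rh-idea-4 (C6⁷), PROVED**: below `b_L(γ,δ) = (γ²/δ)(log(γ²/δ) − 2)` (and above the law's
threshold `n ≥ 900`) the planted Li sequence stays POSITIVE, given RH for ζ verified to a height `T ≥ 1000` with
`b_L ≤ T²`.  This closes the `BlindL` half of their `stub_li_cost`. -/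
theorem blindL_holds : BlindL := by
  intro T γ δ hT hRH hγ hδ _hδ' hbT n hn hnb
  have hγ0 : γ ≠ 0 := by positivity
  exact plantedLi_pos hT hRH hδ.le hγ0 hn (hnb.trans hbT) (exp_le_of_le_liBlindDegree hγ0 hδ hn hnb)

/-- **RH-FREE, KERNEL corollary at the tree's certified height `T = 10³`** (`riemannHypothesisUpTo_1000`): for every
`γ ≥ 100`, `0 < δ < 1/2` with `b_L(γ,δ) ≤ 10⁶`, `λ_n^{pl} > 0` for all `900 ≤ n ≤ b_L(γ,δ)` — unconditionally. -/
theorem blindL_height1000 {γ δ : ℝ} (hγ : 100 ≤ γ) (hδ : 0 < δ) (hδ' : δ < 1 / 2)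
    (hb : liBlindDegree γ δ ≤ 1000000) {n : ℕ} (hn : 900 ≤ n) (hnb : (n : ℝ) ≤ liBlindDegree γ δ) :
    0 < plantedLi γ δ n :=
  blindL_holds (T := 1000) (by norm_num) riemannHypothesisUpTo_1000 hγ hδ hδ' (by norm_num; linarith) n hn hnb

/-- **DH calibration (RH-FREE, KERNEL)**: for the DH pair `γ₁ = 85.699`, `δ₁ = 0.3085` the planted Li coefficient is
`> 0` for every `900 ≤ n ≤ 23806 = ⌊γ₁²/δ₁⌋` (there `nδ₁/γ₁² ≤ 1`, so `exp ≤ e ≤ 3`); the implicit law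
`plantedLi_pos` reaches `n ≈ 2.9·10⁵` (`exp(nδ₁/γ₁²) ≤ 0.67n + 1`), inside the height-`10³` box `n ≤ 10⁶`. -/
theorem plantedLi_pos_DH {n : ℕ} (hn : 900 ≤ n) (hn' : n ≤ 23806) : 0 < plantedLi 85.699 0.3085 n := by
  have hn1 : (n : ℝ) ≤ 23806 := by exact_mod_cast hn'
  have hn2 : (900 : ℝ) ≤ n := by exact_mod_cast hn
  refine plantedLi_pos (T := 1000) (by norm_num) riemannHypothesisUpTo_1000 (by norm_num) (by norm_num) hn
    (by linarith) ?_
  have hu : (n : ℝ) * 0.3085 / (85.699 : ℝ) ^ 2 ≤ 1 := by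
    rw [div_le_iff₀ (by positivity)]
    nlinarith
  calc Real.exp (n * 0.3085 / (85.699 : ℝ) ^ 2) ≤ Real.exp 1 := Real.exp_le_exp.2 hu
    _ ≤ 3 := by have := Real.exp_one_lt_d9; linarith
    _ ≤ 0.67 * n + 1 := by linarith

/-- `b_L(DH) ≤ 10⁶`: the DH blind degree lies inside the height-`10³` box (`log(γ₁²/δ₁) ≤ 12`, `γ₁²/δ₁ ≤ 23807`). -/
theorem liBlindDegree_DH_le : liBlindDegree 85.699 0.3085 ≤ (1000 : ℝ) ^ 2 := by
  unfold liBlindDegree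
  have hq : (0 : ℝ) < 85.699 ^ 2 / 0.3085 := by positivity
  have hlog : Real.log ((85.699 : ℝ) ^ 2 / 0.3085) ≤ 12 := by
    rw [Real.log_le_iff_le_exp hq]
    have h1 : (2.7182818283 : ℝ) ^ 12 ≤ Real.exp 1 ^ 12 :=
      pow_le_pow_left₀ (by norm_num) Real.exp_one_gt_d9.le 12
    rw [← Real.exp_nat_mul] at h1
    norm_num at h1 ⊢
    linarith
  have hq' : (85.699 : ℝ) ^ 2 / 0.3085 ≤ 23807 := by norm_num
  nlinarith [hq]

/-- **DH calibration, logarithmic range (RH-FREE, KERNEL)**: `λ_n^{pl}(γ₁, δ₁) > 0` for every `900 ≤ n ≤ b_L(γ₁,δ₁)`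
(`b_L(85.699, 0.3085) = (γ₁²/δ₁)(log(γ₁²/δ₁) − 2) ≈ 1.92·10⁵`, numerics) — `plantedLi_pos` at `riemannHypothesisUpTo_1000`
through `exp_le_of_le_liBlindDegree` (no `γ ≥ 100` needed). -/
theorem plantedLi_pos_DH_log {n : ℕ} (hn : 900 ≤ n) (hnb : (n : ℝ) ≤ liBlindDegree 85.699 0.3085) :
    0 < plantedLi 85.699 0.3085 n :=
  plantedLi_pos (T := 1000) (by norm_num) riemannHypothesisUpTo_1000 (by norm_num) (by norm_num) hn
    (hnb.trans liBlindDegree_DH_le) (exp_le_of_le_liBlindDegree (by norm_num) (by norm_num) hn hnb)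

/-- The blindness law in the cell's `¬ sees` shape: no planted Li coefficient with `900 ≤ n ≤ b_L(γ,δ)` is `≤ 0`. -/
theorem not_liSees_below {T γ δ : ℝ} (hT : 1000 ≤ T) (hRH : RiemannHypothesisUpTo T) (hγ : 100 ≤ γ)
    (hδ : 0 < δ) (hδ' : δ < 1 / 2) (hbT : liBlindDegree γ δ ≤ T ^ 2) :
    ¬ ∃ n : ℕ, 900 ≤ n ∧ (n : ℝ) ≤ liBlindDegree γ δ ∧ plantedLi γ δ n ≤ 0 := by
  rintro ⟨n, hn, hnb, hle⟩
  exact absurd (blindL_holds hT hRH hγ hδ hδ' hbT n hn hnb) (not_lt.2 hle)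

end RhIdea6.G15.C47b

end
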